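import Literature.AlgebraicGeometry.Motives.FrobIntegralPartTopIffFrobeniusSemisimple
import Literature.AlgebraicGeometry.Motives.FrobIntegralPartFunctoriality
import Mathlib.RingTheory.TensorProduct.Maps
import Mathlib.LinearAlgebra.Semisimple
import Mathlib.FieldTheory.Perfect
import HarnessLib

/-!
# `F_b` is multiplicative: `F^r_b Hⁱ(X) ∪ F^s_b Hʲ(X) ⊆ F^{r+s}_b H^{i+j}(X)`
# (Milne–Ramachandran 2006, §1.1 and Rem. 1.4: cup products of effective semisimple Tate
# substructures)

Topic `Literature/AlgebraicGeometry/Motives`; THEOREMS ONLY (no definition, no instance, no named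
fact; D-0026).

J. S. Milne, N. Ramachandran, *Motivic complexes over finite fields and the ring of correspondences at
the generic point*, arXiv:math/0607483 [MilneRamachandran2006] §1 (held text `arXiv:math/0607483`,
chunk p0003): §1.1 (L31–L45) «Define a Tate structure to be a finite-dimensional `ℚ_l`-vector space
with a linear (Frobenius) map `ϖ` whose characteristic polynomial lies in `ℚ[T]` and whose eigenvalues
are Weil `q`-numbers […]. When the eigenvalues are all of weight `m` (resp. algebraic integers, resp.
semisimple), we say that `V` is of weight `m` (resp. effective, resp. semisimple).»; Rem. 1.4 (L77–L88)
«there is a subspace `F^r_b Hⁱ_l(X)` of `Hⁱ_l(X)` that becomes the sum of the eigenspaces of these `α`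
over `ℚ_l^{al}`» (`α` the eigenvalues of `ϖ_X` with `α/q^r` an algebraic integer). «It is the largest
semisimple Tate substructure of `Hⁱ_l(X)` whose twist by `ℚ_l(r)` is still effective»; and the proof of
Lemma 1.9 (chunk p0004 L103–L110) works inside `H^{2d+2r}_l(T × X)(d+r) ⊃ H^{2d+2r−i}_l(T)(d+r) ⊗ Hⁱ_l(X)`
with the Frobenius acting diagonally on the Künneth/cup product.  J. Tate, *Conjectures on algebraic
cycles in ℓ-adic cohomology* [Tate1994] §1: the cup product is `Γ_k`-equivariant (the tree's axiom
`GaloisWeilCohomology.cup_ρ`).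

The consequence recorded here — for the tree's abstract `E : GaloisWeilCohomology k K χ` over a FINITE
field `k` (`Motives/GeneralizedTateConjecture`: `E.frobenius X i = ϖ = ρ(F)`,
`E.IsEffectiveTwistSubspace X i r V` := «`V` is `ϖ`-stable and `ϖ_r := (q⁻¹)^r • ϖ` is killed on `V` by
a MONIC INTEGER polynomial SQUAREFREE over `ℚ`», `E.frobIntegralPart X i r = F^r_b Hⁱ(X)` := `⨆` of
these `V`) and `X` smooth projective — is the MULTIPLICATIVITY OF `F_b` UNDER THE CUP PRODUCT:

  **`a ∈ F^r_b Hⁱ(X)`, `b ∈ F^s_b Hʲ(X)` ⟹ `a ∪ b ∈ F^{r+s}_b H^{i+j}(X)`**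

(if `ϖ a = α a`, `ϖ b = β b` with `α/q^r`, `β/q^s` algebraic integers then `ϖ(a ∪ b) = αβ (a ∪ b)` and
`αβ/q^{r+s}` is an algebraic integer — products of algebraic integers are algebraic integers,
[AtiyahMacdonald1969] Cor. 5.3; semisimplicity is preserved because the product of two COMMUTING
semisimple operators over a field of characteristic zero is semisimple — Mathlib
`Module.End.IsSemisimple.mul_of_commute`).  Row g39-#12 (`Motives/FrobIntegralPartFunctoriality`,
`cup_mem_frobIntegralPart`) had the special case of a Galois-INVARIANT twisted class `b`.

* §1 (pure algebra) **the product of two commuting operators each killed by a monic integer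
  polynomial squarefree over `ℚ` is killed by such a polynomial**
  (`exists_monic_squarefree_aeval_mul_eq_zero_of_commute`): `f g` is integral over `ℤ` (the
  subring `ℤ[f, g]` is commutative; Mathlib `IsIntegral.mul` there) and semisimple (Mathlib
  `IsSemisimple.mul_of_commute`), and a semisimple operator with a monic integral annihilating
  polynomial has a monic integral SQUAREFREE one (row g39-#10's
  `exists_monic_squarefree_aeval_eq_zero_of_isSemisimple`: radical + Gauss).  Tensor form
  (`exists_monic_squarefree_aeval_tensorMap_eq_zero`): `f ⊗ g = (f ⊗ 1)(1 ⊗ g)` on `V ⊗_K W`.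
* §2 **`F^r_b Hⁱ(X) ∪ F^s_b Hʲ(X) ⊆ F^{r+s}_b H^{i+j}(X)`** for `X` smooth projective
  (`cup_mem_frobIntegralPart_of_mem`, `map₂_cup_frobIntegralPart_le`): the image `W` of
  `F^r_b ⊗ F^s_b` under the cup product is `ϖ`-stable (`ϖ(a ∪ b) = ϖ a ∪ ϖ b`, `cup_ρ`), and
  `ϖ_{r+s} ∘ ∪ = ∪ ∘ (ϖ_r ⊗ ϖ_s)` (`smul_frobenius_comp_liftCup`), so the polynomial of §1 for
  `ϖ_r|F^r_b ⊗ ϖ_s|F^s_b` (both killed by monic integer squarefree polynomials: Rem. 1.4 «the largest»,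
  row g39-#9 `isEffectiveTwistSubspace_frobIntegralPart_of_isSmoothProjective`) kills `ϖ_{r+s}` on `W`
  (`IsEffectiveTwistSubspace.range_liftCup`).  Corollaries: `ϖ 1 = 1` and `1 ∈ F⁰_b H⁰(X)`
  (`frobenius_one`, `one_mem_frobIntegralPart`); powers `η ∈ F^r_b H²(X) ⟹ ηⁿ ∈ F^{nr}_b H²ⁿ(X)`
  via the tree's `PreWeilCohomology.pow` (`pow_mem_frobIntegralPart`; e.g. `r = 1` for a divisor
  class) and the iterated Lefschetz operator `x ↦ x ∪ ηⁿ` (`lefschetzPow_mem_frobIntegralPart`); the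
  SEMISIMPLE PARTS multiply: `F⁰_b Hⁱ ∪ F⁰_b Hʲ ⊆ F⁰_b H^{i+j}` (`cup_mem_frobIntegralPart_zero`), and
  `F⁰_b H^{i+j}(X) = H^{i+j}(X)` as soon as `F⁰_b Hⁱ = Hⁱ`, `F⁰_b Hʲ = Hʲ` and `Hⁱ ∪ Hʲ` spans
  `H^{i+j}` (`frobIntegralPart_eq_top_of_map₂_cup_eq_top`).
* §3 **external products**: for `X`, `Y` smooth projective, `a ∈ F^r_b Hⁱ(X)`, `b ∈ F^s_b Hʲ(Y)` ⟹
  `pr₁^* a ∪ pr₂^* b ∈ F^{r+s}_b H^{i+j}(X × Y)` (`externalCup_mem_frobIntegralPart`; pull-backs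
  respect `F_b`, row g39-#12).

What is NOT here: the converse-type Künneth DECOMPOSITION `F_b Hⁿ(X × Y) = Σ F_b Hⁱ(X) ⊗ F_b Hʲ(Y)`
(needs the eigenvalue description over `ℚ_l^{al}`), and anything on the coniveau side `F_a`.  HC is
not touched.

## References

* [MilneRamachandran2006] J. S. Milne, N. Ramachandran, arXiv:math/0607483, §1.1, Rem. 1.4, Lemma 1.9.
* [Tate1994] J. Tate, *Conjectures on algebraic cycles in ℓ-adic cohomology*, PSPM 55 (1994), §1.
* [AtiyahMacdonald1969] M. F. Atiyah, I. G. Macdonald, *Introduction to Commutative Algebra*, Ch. 5,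
  Cor. 5.3 (the integral elements form a ring).
* [Kleiman1968] S. Kleiman, *Algebraic cycles and the Weil conjectures*, §1.2 (`1 ∪ a = a`).

## Provenance

Lane `lit-hodgefound` (summit `HodgeConjecture`, Track 2 foundations library, Layer B: motives),
seat `lit-hodgefound-p29` (literature-prover, generation 40, row g40-#1).
-/

noncomputable section

open Polynomial
open scoped TensorProduct

universe u v

namespace Literature.AlgebraicGeometry.Motives

/-! ### §1 Products of commuting operators killed by monic integer polynomials squarefree over `ℚ` -/

section Pure

variable {K : Type*} [Field K] [CharZero K]

open IsMulCommutative in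
/-- The product of two COMMUTING elements of a ring that are integral over `ℤ` is integral over
`ℤ`: the subring `ℤ[f, g]` is commutative, and there the integral elements form a subring (Mathlib
`IsIntegral.mul`). [folklore] -/
private theorem isIntegral_mul_of_commute {B : Type*} [Ring B] {f g : B} (hc : Commute f g)
    (hf : IsIntegral ℤ f) (hg : IsIntegral ℤ g) : IsIntegral ℤ (f * g) := by
  set S := Algebra.adjoin ℤ ({f, g} : Set B) with hS
  have hcomm : ∀ a ∈ ({f, g} : Set B), ∀ b ∈ ({f, g} : Set B), a * b = b * a := by
    intro a ha b hb
    simp only [Set.mem_insert_iff, Set.mem_singleton_iff] at ha hb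
    rcases ha with rfl | rfl <;> rcases hb with rfl | rfl
    · rfl
    · exact hc.eq
    · exact hc.eq.symm
    · rfl
  haveI := Algebra.isMulCommutative_adjoin ℤ hcomm
  have hfS : f ∈ S := Algebra.subset_adjoin (Set.mem_insert f {g})
  have hgS : g ∈ S := Algebra.subset_adjoin (Set.mem_insert_of_mem f rfl)
  have hf' : IsIntegral ℤ (⟨f, hfS⟩ : S) :=
    (isIntegral_algHom_iff S.val Subtype.val_injective).mp hf
  have hg' : IsIntegral ℤ (⟨g, hgS⟩ : S) :=
    (isIntegral_algHom_iff S.val Subtype.val_injective).mp hg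
  have h : IsIntegral ℤ ((⟨f, hfS⟩ : S) * ⟨g, hgS⟩) := IsIntegral.mul (A := S) hf' hg'
  exact h.map S.val

omit [CharZero K] in
/-- An element of a `K`-algebra killed by (the image of) a monic integer polynomial is integral over
`ℤ`. [folklore] -/
private theorem isIntegral_int_of_aeval_map_eq_zero {B : Type*} [Ring B] [Algebra K B] {f : B}
    {Q : ℤ[X]} (hQm : Q.Monic) (hQ : aeval f (Q.map (Int.castRingHom K)) = 0) :
    IsIntegral ℤ f := by
  refine ⟨Q, hQm, ?_⟩
  rw [show Int.castRingHom K = algebraMap ℤ K from rfl, aeval_map_algebraMap, aeval_def] at hQ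
  exact hQ

omit [CharZero K] in
/-- Conversely, an element integral over `ℤ` is killed by the image of a monic integer polynomial.
[folklore] -/
private theorem exists_monic_aeval_map_eq_zero_of_isIntegral {B : Type*} [Ring B] [Algebra K B]
    {f : B} (hf : IsIntegral ℤ f) : ∃ Q : ℤ[X], Q.Monic ∧ aeval f (Q.map (Int.castRingHom K)) = 0 := by
  obtain ⟨Q, hQm, hQ⟩ := hf
  refine ⟨Q, hQm, ?_⟩
  rw [show Int.castRingHom K = algebraMap ℤ K from rfl, aeval_map_algebraMap, aeval_def]
  exact hQ

/-- Bookkeeping: `(Q ⊗ ℚ) ⊗ K = Q ⊗ K` for an integer polynomial `Q` (private copy of the tree's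
lemma in `Motives/FrobIntegralPartLargestEffectiveTwistSubspace`). [folklore] -/
private theorem map_map_intCast_ratCast' (Q : ℤ[X]) :
    (Q.map (Int.castRingHom ℚ)).map (algebraMap ℚ K) = Q.map (Int.castRingHom K) := by
  rw [Polynomial.map_map]
  congr 1
  exact RingHom.ext_int _ _

/-- An operator on a finite-dimensional space killed by a monic integer polynomial squarefree over
`ℚ` is semisimple (squarefree over `ℚ` ⟹ separable ⟹ squarefree over `K`; Mathlib
`Module.End.isSemisimple_of_squarefree_aeval_eq_zero`). [folklore] -/
private theorem isSemisimple_of_aeval_map_eq_zero {V : Type*} [AddCommGroup V] [Module K V]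
    [FiniteDimensional K V] {f : Module.End K V} {Q : ℤ[X]}
    (hQs : Squarefree (Q.map (Int.castRingHom ℚ))) (hQ : aeval f (Q.map (Int.castRingHom K)) = 0) :
    f.IsSemisimple := by
  refine Module.End.isSemisimple_of_squarefree_aeval_eq_zero (p := Q.map (Int.castRingHom K)) ?_ hQ
  rw [← map_map_intCast_ratCast']
  exact ((PerfectField.separable_iff_squarefree.mpr hQs).map).squarefree

/-- **The product of two commuting operators killed by monic integer polynomials squarefree over
`ℚ` is killed by a monic integer polynomial squarefree over `ℚ`** — the polynomial behind «the
tensor product of two effective semisimple Tate structures is an effective semisimple Tate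
structure» (§1.1: effective = algebraic-integer eigenvalues; products of algebraic integers are
algebraic integers, [AtiyahMacdonald1969] Cor. 5.3): `f g` is integral over `ℤ` and semisimple
(Mathlib `Module.End.IsSemisimple.mul_of_commute`), so the radical of an integral annihilating
polynomial, made integral by Gauss's lemma, is as required (the tree's
`exists_monic_squarefree_aeval_eq_zero_of_isSemisimple`).
[cite: MilneRamachandran2006, §1.1 and Rem. 1.4] [cite: AtiyahMacdonald1969, Ch. 5 Cor. 5.3] -/
theorem exists_monic_squarefree_aeval_mul_eq_zero_of_commute {V : Type*} [AddCommGroup V]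
    [Module K V] [FiniteDimensional K V] {f g : Module.End K V} (hc : Commute f g) {Q₁ Q₂ : ℤ[X]}
    (hQ₁m : Q₁.Monic) (hQ₁s : Squarefree (Q₁.map (Int.castRingHom ℚ)))
    (hQ₁ : aeval f (Q₁.map (Int.castRingHom K)) = 0) (hQ₂m : Q₂.Monic)
    (hQ₂s : Squarefree (Q₂.map (Int.castRingHom ℚ))) (hQ₂ : aeval g (Q₂.map (Int.castRingHom K)) = 0) :
    ∃ Q : ℤ[X], Q.Monic ∧ Squarefree (Q.map (Int.castRingHom ℚ)) ∧
      aeval (f * g) (Q.map (Int.castRingHom K)) = 0 := by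
  have hint : IsIntegral ℤ (f * g) :=
    isIntegral_mul_of_commute hc (isIntegral_int_of_aeval_map_eq_zero hQ₁m hQ₁)
      (isIntegral_int_of_aeval_map_eq_zero hQ₂m hQ₂)
  obtain ⟨R, hRm, hR⟩ := exists_monic_aeval_map_eq_zero_of_isIntegral (K := K) hint
  have hss : (f * g).IsSemisimple :=
    (isSemisimple_of_aeval_map_eq_zero hQ₁s hQ₁).mul_of_commute hc
      (isSemisimple_of_aeval_map_eq_zero hQ₂s hQ₂)
  exact exists_monic_squarefree_aeval_eq_zero_of_isSemisimple (f * g) hss hRm hR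

omit [CharZero K] in
/-- A polynomial in `f ⊗ 1` is `P(f) ⊗ 1` (`f ↦ f ⊗ 1` is an algebra map, Mathlib
`Module.End.rTensorAlgHom`). [folklore] -/
private theorem aeval_rTensor {V W : Type*} [AddCommGroup V] [Module K V] [AddCommGroup W]
    [Module K W] (f : Module.End K V) (P : K[X]) :
    aeval (f.rTensor W) P = (aeval f P).rTensor W := by
  rw [show f.rTensor W = Module.End.rTensorAlgHom K V W f from rfl, aeval_algHom_apply]
  rfl

omit [CharZero K] in
/-- A polynomial in `1 ⊗ g` is `1 ⊗ P(g)`. [folklore] -/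
private theorem aeval_lTensor {V W : Type*} [AddCommGroup V] [Module K V] [AddCommGroup W]
    [Module K W] (g : Module.End K W) (P : K[X]) :
    aeval (g.lTensor V) P = (aeval g P).lTensor V := by
  rw [show g.lTensor V = Module.End.lTensorAlgHom K W V g from rfl, aeval_algHom_apply]
  rfl

/-- **Tensor form**: if `f ∈ End V` and `g ∈ End W` are killed by monic integer polynomials
squarefree over `ℚ`, so is `f ⊗ g ∈ End (V ⊗_K W)` (`f ⊗ g = (f ⊗ 1)(1 ⊗ g)`, commuting factors).
The tensor product of two effective semisimple Tate structures is effective semisimple.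
[cite: MilneRamachandran2006, §1.1 and Rem. 1.4] [cite: AtiyahMacdonald1969, Ch. 5 Cor. 5.3] -/
theorem exists_monic_squarefree_aeval_tensorMap_eq_zero {V W : Type*} [AddCommGroup V] [Module K V]
    [FiniteDimensional K V] [AddCommGroup W] [Module K W] [FiniteDimensional K W]
    {f : Module.End K V} {g : Module.End K W} {Q₁ Q₂ : ℤ[X]}
    (hQ₁m : Q₁.Monic) (hQ₁s : Squarefree (Q₁.map (Int.castRingHom ℚ)))
    (hQ₁ : aeval f (Q₁.map (Int.castRingHom K)) = 0) (hQ₂m : Q₂.Monic)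
    (hQ₂s : Squarefree (Q₂.map (Int.castRingHom ℚ))) (hQ₂ : aeval g (Q₂.map (Int.castRingHom K)) = 0) :
    ∃ Q : ℤ[X], Q.Monic ∧ Squarefree (Q.map (Int.castRingHom ℚ)) ∧
      aeval (TensorProduct.map f g) (Q.map (Int.castRingHom K)) = 0 := by
  have hprod : f.rTensor W * g.lTensor V = TensorProduct.map f g := by
    rw [Module.End.mul_eq_comp, LinearMap.rTensor_comp_lTensor]
  have hc : Commute (f.rTensor W) (g.lTensor V) := by
    change f.rTensor W * g.lTensor V = g.lTensor V * f.rTensor W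
    rw [hprod, Module.End.mul_eq_comp, LinearMap.lTensor_comp_rTensor]
  have h₁ : aeval (f.rTensor W) (Q₁.map (Int.castRingHom K)) = 0 := by
    rw [aeval_rTensor, hQ₁, LinearMap.rTensor_zero]
  have h₂ : aeval (g.lTensor V) (Q₂.map (Int.castRingHom K)) = 0 := by
    rw [aeval_lTensor, hQ₂, LinearMap.lTensor_zero]
  rw [← hprod]
  exact exists_monic_squarefree_aeval_mul_eq_zero_of_commute hc hQ₁m hQ₁s h₁ hQ₂m hQ₂s h₂

omit [CharZero K] in
/-- A linear map intertwining `f` and `g` intertwines polynomials in them: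
`g ∘ T = T ∘ f ⟹ P(g) ∘ T = T ∘ P(f)` (private copy of the tree's lemma in
`Motives/FrobIntegralPartFunctoriality`). [folklore] -/
private theorem aeval_comp_eq_comp_aeval' {V W : Type*} [AddCommGroup V] [Module K V]
    [AddCommGroup W] [Module K W] {f : Module.End K V} {g : Module.End K W} {T : V →ₗ[K] W}
    (h : g ∘ₗ T = T ∘ₗ f) (P : K[X]) : aeval g P ∘ₗ T = T ∘ₗ aeval f P := by
  induction P using Polynomial.induction_on' with
  | add P Q hP hQ => rw [map_add, map_add, LinearMap.add_comp, LinearMap.comp_add, hP, hQ]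
  | monomial n a =>
    rw [aeval_monomial, aeval_monomial, ← Algebra.smul_def, ← Algebra.smul_def,
      LinearMap.smul_comp, LinearMap.comp_smul]
    congr 1
    exact Module.End.commute_pow_left_of_commute h n

omit [CharZero K] in
/-- The restriction of `P(f)` to an `f`-stable subspace, composed with the inclusion, is `P(f)` on the
subspace: `P(f) ∘ ι = ι ∘ P(f|_V)`. [folklore] -/
private theorem aeval_comp_subtype_eq {V : Type*} [AddCommGroup V] [Module K V] {f : Module.End K V}
    {p : Submodule K V} (hf : ∀ x ∈ p, f x ∈ p) (P : K[X]) :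
    aeval f P ∘ₗ p.subtype = p.subtype ∘ₗ aeval (f.restrict hf) P :=
  aeval_comp_eq_comp_aeval' (f := f.restrict hf) (g := f) (T := p.subtype) (LinearMap.ext fun _ ↦ rfl) P

end Pure

/-! ### §2 `F^r_b Hⁱ(X) ∪ F^s_b Hʲ(X) ⊆ F^{r+s}_b H^{i+j}(X)` -/

namespace GaloisWeilCohomology

variable {k : Type u} [Field k] [Finite k] {K : Type v} [Field K] [CharZero K]
  {χ : Field.absoluteGaloisGroup k →* Kˣ} (E : GaloisWeilCohomology k K χ)
variable {d : ℕ} {X : SchemeOver k}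

/-- **`ϖ (a ∪ b) = ϖ a ∪ ϖ b`** (`X` smooth projective): the Frobenius `ϖ = ρ(F)` is multiplicative
(Tate 1994 §1, the tree's `cup_ρ`). [cite: Tate1994, §1] [cite: MilneRamachandran2006, §1.1] -/
theorem frobenius_cup (hX : IsSmoothProjective d X) {i j m : ℕ} (h : i + j = m) (a : E.obj X i)
    (b : E.obj X j) :
    E.frobenius X m (E.cup h a b) = E.cup h (E.frobenius X i a) (E.frobenius X j b) := by
  rw [frobenius_apply, frobenius_apply, frobenius_apply]
  exact E.cup_ρ hX h (geomFrob k) a b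

/-- **`ϖ_{r+s} (a ∪ b) = ϖ_r a ∪ ϖ_s b`** (`ϖ_r = (q⁻¹)^r • ϖ`; bilinearity of `∪`).
[cite: Tate1994, §1] [cite: MilneRamachandran2006, §1 Rem. 1.4] -/
theorem smul_frobenius_cup (hX : IsSmoothProjective d X) {i j m : ℕ} (h : i + j = m) (r s : ℕ)
    (a : E.obj X i) (b : E.obj X j) :
    (((Nat.card k : K)⁻¹ ^ (r + s)) • E.frobenius X m) (E.cup h a b) =
      E.cup h ((((Nat.card k : K)⁻¹ ^ r) • E.frobenius X i) a)
        ((((Nat.card k : K)⁻¹ ^ s) • E.frobenius X j) b) := by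
  simp only [LinearMap.smul_apply, map_smul, LinearMap.smul_apply]
  rw [E.frobenius_cup hX h, smul_smul, ← pow_add, add_comm s r]

omit [Finite k] in
/-- The cup product on `V ⊗ W` for subspaces `V ⊆ Hⁱ(X)`, `W ⊆ Hʲ(X)`, as ONE linear map
`V ⊗_K W → Hᵐ(X)`, evaluated on a pure tensor. [folklore] -/
private theorem liftCup_tmul {i j m : ℕ} (h : i + j = m) (V : Submodule K (E.obj X i))
    (W : Submodule K (E.obj X j)) (a : V) (b : W) :
    (TensorProduct.lift (E.cup h) ∘ₗ TensorProduct.map V.subtype W.subtype) (a ⊗ₜ b) =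
      E.cup h (a : E.obj X i) (b : E.obj X j) := rfl

/-- **`ϖ_{r+s} ∘ ∪ = ∪ ∘ (ϖ_r|_V ⊗ ϖ_s|_W)`** on `V ⊗_K W` for `ϖ`-stable `V ⊆ Hⁱ(X)`, `W ⊆ Hʲ(X)`
(`X` smooth projective). [cite: Tate1994, §1] [cite: MilneRamachandran2006, §1 Rem. 1.4] -/
theorem smul_frobenius_comp_liftCup (hX : IsSmoothProjective d X) {i j m : ℕ} (h : i + j = m)
    (r s : ℕ) {V : Submodule K (E.obj X i)} {W : Submodule K (E.obj X j)}
    (hV : ∀ x ∈ V, (((Nat.card k : K)⁻¹ ^ r) • E.frobenius X i) x ∈ V)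
    (hW : ∀ x ∈ W, (((Nat.card k : K)⁻¹ ^ s) • E.frobenius X j) x ∈ W) :
    (((Nat.card k : K)⁻¹ ^ (r + s)) • E.frobenius X m) ∘ₗ
        (TensorProduct.lift (E.cup h) ∘ₗ TensorProduct.map V.subtype W.subtype) =
      (TensorProduct.lift (E.cup h) ∘ₗ TensorProduct.map V.subtype W.subtype) ∘ₗ
        TensorProduct.map ((((Nat.card k : K)⁻¹ ^ r) • E.frobenius X i).restrict hV)
          ((((Nat.card k : K)⁻¹ ^ s) • E.frobenius X j).restrict hW) := by
  refine TensorProduct.ext' fun a b ↦ ?_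
  rw [LinearMap.comp_apply, liftCup_tmul, LinearMap.comp_apply, TensorProduct.map_tmul,
    liftCup_tmul, E.smul_frobenius_cup hX h r s]
  rfl

variable {E} in
/-- **The image of `V ⊗ W` under the cup product is an effective-twist subspace for `r + s`** when
`V ⊆ Hⁱ(X)` is one for `r` and `W ⊆ Hʲ(X)` is one for `s` (`X` smooth projective): it is `ϖ`-stable
(`ϖ(a ∪ b) = ϖ a ∪ ϖ b`), and the monic integer squarefree polynomial of §1 for `ϖ_r|_V ⊗ ϖ_s|_W`
kills `ϖ_{r+s}` on it. The cup product of two effective semisimple Tate substructures is an effective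
semisimple Tate substructure of the twist `r + s`.
[cite: MilneRamachandran2006, §1.1 and Rem. 1.4] [cite: Tate1994, §1] -/
theorem IsEffectiveTwistSubspace.range_liftCup (hX : IsSmoothProjective d X) {i j m : ℕ}
    (h : i + j = m) {r s : ℕ} {V : Submodule K (E.obj X i)} {W : Submodule K (E.obj X j)}
    (hV : E.IsEffectiveTwistSubspace X i r V) (hW : E.IsEffectiveTwistSubspace X j s W) :
    E.IsEffectiveTwistSubspace X m (r + s)
      (LinearMap.range (TensorProduct.lift (E.cup h) ∘ₗ TensorProduct.map V.subtype W.subtype)) := by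
  haveI := E.finite_obj hX i
  haveI := E.finite_obj hX j
  obtain ⟨hVst, Q₁, hQ₁m, hQ₁s, hQ₁⟩ := hV
  obtain ⟨hWst, Q₂, hQ₂m, hQ₂s, hQ₂⟩ := hW
  -- `ϖ_r` and `ϖ_s` preserve `V` and `W`
  have hV' : ∀ x ∈ V, (((Nat.card k : K)⁻¹ ^ r) • E.frobenius X i) x ∈ V :=
    fun x hx ↦ Submodule.smul_mem _ _ (hVst x hx)
  have hW' : ∀ x ∈ W, (((Nat.card k : K)⁻¹ ^ s) • E.frobenius X j) x ∈ W :=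
    fun x hx ↦ Submodule.smul_mem _ _ (hWst x hx)
  have hinter := E.smul_frobenius_comp_liftCup hX h r s hV' hW'
  have hq : ((Nat.card k : K)⁻¹ ^ (r + s)) ≠ 0 :=
    pow_ne_zero _ (inv_ne_zero (by exact_mod_cast Nat.card_pos.ne'))
  -- the restricted operators are killed by `Q₁`, `Q₂`
  have hf0 : aeval ((((Nat.card k : K)⁻¹ ^ r) • E.frobenius X i).restrict hV')
      (Q₁.map (Int.castRingHom K)) = 0 := by
    apply LinearMap.ext
    rintro ⟨v, hv⟩
    apply Subtype.ext
    have := LinearMap.congr_fun (aeval_comp_subtype_eq hV' (Q₁.map (Int.castRingHom K))) ⟨v, hv⟩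
    simp only [LinearMap.comp_apply, Submodule.subtype_apply] at this
    rw [LinearMap.zero_apply, Submodule.coe_zero, ← this]
    exact hQ₁ v hv
  have hg0 : aeval ((((Nat.card k : K)⁻¹ ^ s) • E.frobenius X j).restrict hW')
      (Q₂.map (Int.castRingHom K)) = 0 := by
    apply LinearMap.ext
    rintro ⟨w, hw⟩
    apply Subtype.ext
    have := LinearMap.congr_fun (aeval_comp_subtype_eq hW' (Q₂.map (Int.castRingHom K))) ⟨w, hw⟩
    simp only [LinearMap.comp_apply, Submodule.subtype_apply] at this
    rw [LinearMap.zero_apply, Submodule.coe_zero, ← this]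
    exact hQ₂ w hw
  obtain ⟨Q, hQm, hQs, hQ⟩ :=
    exists_monic_squarefree_aeval_tensorMap_eq_zero hQ₁m hQ₁s hf0 hQ₂m hQ₂s hg0
  refine ⟨fun y hy ↦ ?_, Q, hQm, hQs, fun y hy ↦ ?_⟩
  · -- `ϖ`-stability: `ϖ (a ∪ b) = q^{r+s} · ((ϖ_r a) ∪ (ϖ_s b))`
    obtain ⟨t, rfl⟩ := LinearMap.mem_range.mp hy
    have ht := LinearMap.congr_fun hinter t
    simp only [LinearMap.comp_apply, LinearMap.smul_apply] at ht
    have h' : E.frobenius X m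
        (TensorProduct.lift (E.cup h) (TensorProduct.map V.subtype W.subtype t)) =
        ((Nat.card k : K)⁻¹ ^ (r + s))⁻¹ •
          TensorProduct.lift (E.cup h) (TensorProduct.map V.subtype W.subtype
            (TensorProduct.map ((((Nat.card k : K)⁻¹ ^ r) • E.frobenius X i).restrict hV')
              ((((Nat.card k : K)⁻¹ ^ s) • E.frobenius X j).restrict hW') t)) := by
      rw [← ht, smul_smul, inv_mul_cancel₀ hq, one_smul]
    rw [LinearMap.comp_apply, h']
    exact Submodule.smul_mem _ _ (LinearMap.mem_range.mpr ⟨_, rfl⟩)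
  · obtain ⟨t, rfl⟩ := LinearMap.mem_range.mp hy
    have ht := LinearMap.congr_fun (aeval_comp_eq_comp_aeval' hinter (Q.map (Int.castRingHom K))) t
    simp only [LinearMap.comp_apply] at ht ⊢
    rw [ht, hQ, LinearMap.zero_apply, map_zero, map_zero]

/-- **MULTIPLICATIVITY OF `F_b`: `a ∈ F^r_b Hⁱ(X)`, `b ∈ F^s_b Hʲ(X)` ⟹ `a ∪ b ∈ F^{r+s}_b H^{i+j}(X)`**
(`X` smooth projective over the finite field `k`).  If `ϖ a = α a` and `ϖ b = β b` with `α/q^r` and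
`β/q^s` algebraic integers, then `ϖ (a ∪ b) = αβ (a ∪ b)` with `αβ/q^{r+s}` an algebraic integer:
`F^r_b` and `F^s_b` are themselves effective-twist subspaces (Rem. 1.4 «the largest», row g39-#9),
and so is the image of `F^r_b ⊗ F^s_b` under `∪` (`IsEffectiveTwistSubspace.range_liftCup`).
[cite: MilneRamachandran2006, §1.1 and Rem. 1.4] [cite: Tate1994, §1] -/
theorem cup_mem_frobIntegralPart_of_mem (hX : IsSmoothProjective d X) {i j m : ℕ} (h : i + j = m)
    {r s : ℕ} {a : E.obj X i} (ha : a ∈ E.frobIntegralPart X i r) {b : E.obj X j}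
    (hb : b ∈ E.frobIntegralPart X j s) : E.cup h a b ∈ E.frobIntegralPart X m (r + s) := by
  have hW := (E.isEffectiveTwistSubspace_frobIntegralPart_of_isSmoothProjective hX i r).range_liftCup
    hX h (E.isEffectiveTwistSubspace_frobIntegralPart_of_isSmoothProjective hX j s)
  refine E.le_frobIntegralPart hW (LinearMap.mem_range.mpr ⟨⟨a, ha⟩ ⊗ₜ ⟨b, hb⟩, ?_⟩)
  rfl

/-- **`F^r_b Hⁱ(X) ∪ F^s_b Hʲ(X) ⊆ F^{r+s}_b H^{i+j}(X)`**, submodule form (Mathlib `Submodule.map₂`).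
[cite: MilneRamachandran2006, §1.1 and Rem. 1.4] [cite: Tate1994, §1] -/
theorem map₂_cup_frobIntegralPart_le (hX : IsSmoothProjective d X) {i j m : ℕ} (h : i + j = m)
    (r s : ℕ) :
    Submodule.map₂ (E.cup h) (E.frobIntegralPart X i r) (E.frobIntegralPart X j s) ≤
      E.frobIntegralPart X m (r + s) :=
  Submodule.map₂_le.mpr fun _ ha _ hb ↦ E.cup_mem_frobIntegralPart_of_mem hX h ha hb

/-- **The semisimple parts multiply: `F⁰_b Hⁱ(X) ∪ F⁰_b Hʲ(X) ⊆ F⁰_b H^{i+j}(X)`** — the cup product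
of classes on which `ϖ` is semisimple (with algebraic-integer eigenvalues) is such a class.
[cite: MilneRamachandran2006, §1.1 and Rem. 1.4] [cite: Tate1994, §1] -/
theorem cup_mem_frobIntegralPart_zero (hX : IsSmoothProjective d X) {i j m : ℕ} (h : i + j = m)
    {a : E.obj X i} (ha : a ∈ E.frobIntegralPart X i 0) {b : E.obj X j}
    (hb : b ∈ E.frobIntegralPart X j 0) : E.cup h a b ∈ E.frobIntegralPart X m 0 := by
  simpa using E.cup_mem_frobIntegralPart_of_mem hX h ha hb

/-- **If `F^r_b Hⁱ(X) = Hⁱ(X)` and `F^s_b Hʲ(X) = Hʲ(X)` then every cup product `a ∪ b` lies in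
`F^{r+s}_b H^{i+j}(X)`**, i.e. the span of the cup products `Hⁱ(X) ∪ Hʲ(X)` lies in `F^{r+s}_b`.
[cite: MilneRamachandran2006, §1.1 and Rem. 1.4] [cite: Tate1994, §1] -/
theorem map₂_cup_top_le_frobIntegralPart (hX : IsSmoothProjective d X) {i j m : ℕ} (h : i + j = m)
    {r s : ℕ} (hi : E.frobIntegralPart X i r = ⊤) (hj : E.frobIntegralPart X j s = ⊤) :
    Submodule.map₂ (E.cup (X := X) h) ⊤ ⊤ ≤ E.frobIntegralPart X m (r + s) := by
  rw [← hi, ← hj]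
  exact E.map₂_cup_frobIntegralPart_le hX h r s

/-- **If `ϖ` is semisimple with algebraic-integer eigenvalues on all of `Hⁱ(X)` and `Hʲ(X)`
(`F⁰_b = ⊤` in both degrees) and `H^{i+j}(X)` is spanned by cup products `Hⁱ ∪ Hʲ`, then
`F⁰_b H^{i+j}(X) = H^{i+j}(X)`** (e.g. towards `H^*(A) = Λ^* H¹(A)` for an abelian variety, §1.1
«semisimple if `X` is an abelian variety ([weil1948], no. 70)»).
[cite: MilneRamachandran2006, §1.1 and Rem. 1.4] [cite: Tate1994, §1] -/
theorem frobIntegralPart_eq_top_of_map₂_cup_eq_top (hX : IsSmoothProjective d X) {i j m : ℕ}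
    (h : i + j = m) {r s : ℕ} (hi : E.frobIntegralPart X i r = ⊤) (hj : E.frobIntegralPart X j s = ⊤)
    (hspan : Submodule.map₂ (E.cup (X := X) h) ⊤ ⊤ = ⊤) : E.frobIntegralPart X m (r + s) = ⊤ :=
  eq_top_iff.mpr (hspan ▸ E.map₂_cup_top_le_frobIntegralPart hX h hi hj)

/-! ### §2b The unit and powers -/

/-- **`ϖ 1 = 1`** (`X` smooth projective): `ϖ = ρ(F)` is an algebra automorphism of `H^*(X)`
(`cup_ρ`) and `1 ∪ a = a` (`one_cup`): with `u = ρ(F⁻¹) 1`, `1 = ϖ u = ϖ(1 ∪ u) = ϖ 1 ∪ 1 = ϖ 1`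
(the last step by graded commutativity in degree `0` and `one_cup`).
[cite: Tate1994, §1] [cite: Kleiman1968, §1.2] -/
theorem frobenius_one (hX : IsSmoothProjective d X) : E.frobenius X 0 (E.one X) = E.one X := by
  have hinv : E.frobenius X 0 (E.ρ X 0 (geomFrob k)⁻¹ (E.one X)) = E.one X := by
    rw [frobenius_apply, ← Module.End.mul_apply, ← map_mul, mul_inv_cancel, map_one,
      Module.End.one_apply]
  -- `1 = ϖ 1 ∪ 1`
  have h1 : E.one X = E.cup (zero_add 0) (E.frobenius X 0 (E.one X)) (E.one X) := by
    conv_lhs => rw [← hinv, ← E.one_cup hX (zero_add 0) (E.ρ X 0 (geomFrob k)⁻¹ (E.one X)),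
      E.frobenius_cup hX, hinv]
  calc E.frobenius X 0 (E.one X)
      = E.cup (zero_add 0) (E.one X) (E.frobenius X 0 (E.one X)) := (E.one_cup hX _ _).symm
    _ = E.cup (zero_add 0) (E.frobenius X 0 (E.one X)) (E.one X) := by
        rw [E.cup_comm hX (zero_add 0) (zero_add 0) (E.frobenius X 0 (E.one X)) (E.one X)]
        simp
    _ = E.one X := h1.symm

/-- **`1 ∈ F⁰_b H⁰(X)`** (`ϖ 1 = 1`: killed by `T − 1`). [cite: MilneRamachandran2006, §1 Rem. 1.4] [cite: Tate1994, §1] -/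
theorem one_mem_frobIntegralPart (hX : IsSmoothProjective d X) : E.one X ∈ E.frobIntegralPart X 0 0 := by
  refine E.mem_frobIntegralPart_of_pow_apply_eq (N := 1) one_pos ?_
  rw [pow_one, pow_zero, one_smul, E.frobenius_one hX]

/-- **Powers: `η ∈ F^r_b H²(X)` ⟹ `ηⁿ ∈ F^{n r}_b H^{2n}(X)`** (the tree's `PreWeilCohomology.pow`:
`η⁰ = 1`, `ηⁿ⁺¹ = ηⁿ ∪ η`); e.g. `η` the class of a divisor (`r = 1`, algebraic classes lie in
`F^1_b H²`, row g39-#8) gives `ηⁿ ∈ Fⁿ_b H²ⁿ(X)`.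
[cite: MilneRamachandran2006, §1.1 and Rem. 1.4] [cite: Tate1994, §1] -/
theorem pow_mem_frobIntegralPart (hX : IsSmoothProjective d X) {r : ℕ} {η : E.obj X 2}
    (hη : η ∈ E.frobIntegralPart X 2 r) (n : ℕ) : E.pow X η n ∈ E.frobIntegralPart X (2 * n) (n * r) := by
  induction n with
  | zero =>
    rw [zero_mul]
    exact E.one_mem_frobIntegralPart hX
  | succ n ih =>
    rw [PreWeilCohomology.pow_succ, show (n + 1) * r = n * r + r by ring]
    exact E.cup_mem_frobIntegralPart_of_mem hX rfl ih hη

/-- **Iterated Lefschetz operators respect `F_b` with a shift: `Lⁿ(F^s_b Hⁱ(X)) ⊆ F^{s+nr}_b H^{i+2n}(X)`**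
for `η ∈ F^r_b H²(X)` (`Lⁿ x = x ∪ ηⁿ`, the tree's `PreWeilCohomology.lefschetzPow`).
[cite: MilneRamachandran2006, §1.1 and Rem. 1.4] [cite: Tate1994, §1] -/
theorem lefschetzPow_mem_frobIntegralPart (hX : IsSmoothProjective d X) {r : ℕ} {η : E.obj X 2}
    (hη : η ∈ E.frobIntegralPart X 2 r) (n : ℕ) {i j : ℕ} (h : i + 2 * n = j) {s : ℕ} {x : E.obj X i}
    (hx : x ∈ E.frobIntegralPart X i s) :
    E.lefschetzPow X η n i j h x ∈ E.frobIntegralPart X j (s + n * r) :=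
  E.cup_mem_frobIntegralPart_of_mem hX h hx (E.pow_mem_frobIntegralPart hX hη n)

/-! ### §3 External products on `X × Y` -/

open CategoryTheory MonoidalCategory CartesianMonoidalCategory

variable {e : ℕ} {Y : SchemeOver k}

/-- **External products: `a ∈ F^r_b Hⁱ(X)`, `b ∈ F^s_b Hʲ(Y)` ⟹ `pr₁^* a ∪ pr₂^* b ∈ F^{r+s}_b H^{i+j}(X × Y)`**
(`X`, `Y` smooth projective; pull-backs respect `F_b`, row g39-#12, and `F_b` is multiplicative on
`X × Y`).  Cf. the proof of Lemma 1.9: `H^{2d+2r−i}_l(T)(d+r) ⊗ Hⁱ_l(X) ⊂ H^{2d+2r}_l(T × X)(d+r)` as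
Tate structures. [cite: MilneRamachandran2006, §1 Rem. 1.4 and Lemma 1.9 (proof)] [cite: Tate1994, §1] -/
theorem externalCup_mem_frobIntegralPart (hX : IsSmoothProjective d X) (hY : IsSmoothProjective e Y)
    {i j m : ℕ} (h : i + j = m) {r s : ℕ} {a : E.obj X i} (ha : a ∈ E.frobIntegralPart X i r)
    {b : E.obj Y j} (hb : b ∈ E.frobIntegralPart Y j s) :
    E.externalCup X Y h a b ∈ E.frobIntegralPart (X ⊗ Y) m (r + s) := by
  have hXY : IsSmoothProjective (d + e) (X ⊗ Y) := IsSmoothProjective.tensor_holds hX hY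
  exact E.cup_mem_frobIntegralPart_of_mem hXY h (E.pullback_mem_frobIntegralPart hXY hX (fst X Y) ha)
    (E.pullback_mem_frobIntegralPart hXY hY (snd X Y) hb)

/-- **Künneth pieces of effective semisimple parts: `F⁰_b Hⁱ(X) ⊠ F⁰_b Hʲ(Y) ⊆ F⁰_b H^{i+j}(X × Y)`.**
[cite: MilneRamachandran2006, §1.1 and Rem. 1.4] [cite: Tate1994, §1] -/
theorem externalCup_mem_frobIntegralPart_zero (hX : IsSmoothProjective d X)
    (hY : IsSmoothProjective e Y) {i j m : ℕ} (h : i + j = m) {a : E.obj X i}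
    (ha : a ∈ E.frobIntegralPart X i 0) {b : E.obj Y j} (hb : b ∈ E.frobIntegralPart Y j 0) :
    E.externalCup X Y h a b ∈ E.frobIntegralPart (X ⊗ Y) m 0 := by
  simpa using E.externalCup_mem_frobIntegralPart hX hY h ha hb

end GaloisWeilCohomology

end Literature.AlgebraicGeometry.Motives

end
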